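import Summits.HodgeConjecture.HodgeConjecture.Theorems.K2LiuCartanSeriesGL2Closed

/-!
# The `U(1,1)` (inert) Cartan series of the unramified doubling kernel — the closed form
# `c · (1 − θ(a₁−q+1)q^{−(2s+2)} + θ²q^{−(4s+2)}) = (1 + θq^{−(2s+1)})(1 − θq^{−(2s+2)})` (LOCAL SEAM of s23, inert package, engine of #28i)

Track B ∕ K2-LIT, hLiu418 = stmt-HodgeConjecture-24832; words `K2/K2Liu-p01/g3/INERT-SOCKETS-v2.K2Liup01g3.md` §0–§1 (certificate `check28i.py`,
02732331dfabd5fb). Helper (count-neutral, own head per LEAD R3), PURE ANALYSIS over `ℂ`, the inert twin of ★ `K2LiuCartanSeriesGL2Closed` §5 — but ONE cone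
(`G_v = ⨆_{m ≥ 0} K t^m K` at an inert place, ★ `K2LiuCartanFamilyInert`) instead of three. For a sequence `μ` with the `U(1,1)` (even-distance tree)
Hecke recursion

  `μ₀ = 1`, `μ₁ = a₁`, `μ₂ = (a₁ − q + 1)a₁ − q(q+1)`, `μ_{k+3} = (a₁ − q + 1)μ_{k+2} − q²μ_{k+1}`

(`a₁ = λ(1_{KtK})` in the `ν(K) = 1` currency, `#(KtK/K) = q² + q` ★ `card_orbit_basic_two`; neighbour counts `1 ∕ q−1 ∕ q²` between consecutive
shells of the `(q+1)`-regular tree at even distance) and a SUMMABLE `∑ μ_k Y^k`: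
* `tsum_cartanSeriesU11_mul_quadratic`: `(∑ μ_k Y^k)·(1 − (a₁−q+1)Y + q²Y²) = (1 + qY)(1 − Y)` (★ `tsum_mul_quadratic_of_rec`, division-free);
* `cartanSeriesU11_closed_form`: at `Y = θ·q^{−(2s+2)}` (`θ = χ_w(ϖ_v)`, ★ #27i: `Λ_{s,v}(ι_v(t^m,1)) = θ^m q^{−2m(s+1)}`) this is the #28i identity
  `c·(1 − θ(a₁−q+1)q^{−(2s+2)} + θ²q^{−(4s+2)}) = (1 + θq^{−(2s+1)})(1 − θq^{−(2s+2)})`, i.e. `c = L_w(s+½, BC(σ_v)⊗χ_w)·(1 − χ⁰ε q^{−(2s+1)})(1 − χ⁰q^{−(2s+2)})`,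
  `ε(ϖ_v) = −1` [Li1992, §3 Thm. 3.1]; [GelbartPiatetskishapiroRallis1987, Part A §6]; [Liu2011, §2C (2-4)]; [Macdonald1971, Ch. V §3].
Theorems only; no `sorry`. HONEST LABEL: HC_CM is proved only modulo the printed citations (2 remaining named inputs: hLiu418 = stmt-HodgeConjecture-24832,
h413 = stmt-HodgeConjecture-24833) until rung 0 closes; this file is unconditional and moves no counter.
-/

set_option autoImplicit false

set_option linter.dupNamespace false

noncomputable section

namespace Summit.HodgeConjecture.HodgeConjecture.Cruxes.HLiu418.K2LiuCartanSeriesU11Closed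

open Summit.HodgeConjecture.HodgeConjecture.Cruxes.HLiu418.K2LiuCartanSeriesGL2Closed

/-- **`(∑ μ_k Y^k)·(1 − (a₁−q+1)Y + q²Y²) = (1 + qY)(1 − Y)`** for the `U(1,1)` Hecke recursion. [cite: Macdonald1971, Ch. V §3] [cite: Li1992, §3 Thm. 3.1] -/
theorem tsum_cartanSeriesU11_mul_quadratic {μ : ℕ → ℂ} {a₁ q Y : ℂ} (h0 : μ 0 = 1) (h1 : μ 1 = a₁)
    (h2 : μ 2 = (a₁ - q + 1) * a₁ - q * (q + 1)) (hrec : ∀ k, μ (k + 3) = (a₁ - q + 1) * μ (k + 2) - q ^ 2 * μ (k + 1))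
    (hs : Summable fun k => μ k * Y ^ k) :
    (∑' k, μ k * Y ^ k) * (1 - (a₁ - q + 1) * Y + q ^ 2 * Y ^ 2) = (1 + q * Y) * (1 - Y) := by
  rw [tsum_mul_quadratic_of_rec hrec hs, h0, h1, h2]
  ring

/-- exponent bookkeeping: `x^{−(4s+2)} = x² · (x^{−(2s+2)})²` for `x ≠ 0`. [folklore] -/
theorem cpow_neg_four (x s : ℂ) (hx : x ≠ 0) : x ^ (-(4 * s + 2)) = x ^ 2 * (x ^ (-(2 * s + 2))) ^ 2 := by
  rw [sq (x ^ (-(2 * s + 2))), ← Complex.cpow_add _ _ hx, ← Complex.cpow_natCast, ← Complex.cpow_add _ _ hx]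
  congr 1
  push_cast
  ring

/-- exponent bookkeeping: `x^{−(2s+1)} = x · x^{−(2s+2)}` for `x ≠ 0`. [folklore] -/
theorem cpow_neg_two_add_one (x s : ℂ) (hx : x ≠ 0) : x ^ (-(2 * s + 1)) = x * x ^ (-(2 * s + 2)) := by
  nth_rw 2 [← Complex.cpow_one x]
  rw [← Complex.cpow_add _ _ hx]
  congr 1
  ring

/-- **THE INERT CLOSED FORM OF #28i**: if `c = ∑ μ_m (θ q^{−(2s+2)})^m` (the Cartan series of ★ `K2LiuDoublingHeckeCartanSum.isDoublingHeckeEigenvector_cLoc`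
with ★ #27i's `Λ_m = θ^m q^{−2m(s+1)}`) for a `U(1,1)` Hecke eigenvalue sequence `μ`, then
`c · (1 − θ(a₁−q+1)q^{−(2s+2)} + θ²q^{−(4s+2)}) = (1 + θq^{−(2s+1)})(1 − θq^{−(2s+2)})`.
[cite: Li1992, §3 Thm. 3.1] [cite: GelbartPiatetskishapiroRallis1987, Part A §6] [cite: Liu2011, §2C p. 863] -/
theorem cartanSeriesU11_closed_form {μ : ℕ → ℂ} {a₁ θ q s c : ℂ} (hq : q ≠ 0) (h0 : μ 0 = 1) (h1 : μ 1 = a₁)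
    (h2 : μ 2 = (a₁ - q + 1) * a₁ - q * (q + 1)) (hrec : ∀ k, μ (k + 3) = (a₁ - q + 1) * μ (k + 2) - q ^ 2 * μ (k + 1))
    (hs : Summable fun k => μ k * (θ * q ^ (-(2 * s + 2))) ^ k) (hc : c = ∑' k, μ k * (θ * q ^ (-(2 * s + 2))) ^ k) :
    c * (1 - θ * (a₁ - q + 1) * q ^ (-(2 * s + 2)) + θ ^ 2 * q ^ (-(4 * s + 2))) =
      (1 + θ * q ^ (-(2 * s + 1))) * (1 - θ * q ^ (-(2 * s + 2))) := by
  have h := tsum_cartanSeriesU11_mul_quadratic h0 h1 h2 hrec hs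
  rw [← hc] at h
  rw [cpow_neg_four q s hq, cpow_neg_two_add_one q s hq]
  linear_combination h

end Summit.HodgeConjecture.HodgeConjecture.Cruxes.HLiu418.K2LiuCartanSeriesU11Closed

end
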